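import Literature.MathematicalPhysics.QuantumFieldTheory.BalabanImbrieJaffe1984to88.BIJ85Ineq722Proof

/-!
# `BalabanImbrieJaffe1984to88.BIJ85Ineq722ProofPart2` — T. Bałaban, J. Imbrie, A. Jaffe, *Renormalization of the Higgs model: minimizers,
propagators and the stability of mean field theory*, Commun. Math. Phys. **97** (1985) 299–329 [BalabanImbrieJaffe1985]: Sect. 7.2 p. 325,
**(7.2.2)** — file 2 of 2 of row C1.Eq7.2.1-7.2.2 (file 1 = `…BIJ85Ineq722Proof`: the representation (1.103) `H_k = GQ^*(QGQ^*)⁻¹` as kernels,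
the decay of `(QGQ^*)⁻¹` by the PROVED [7] Sect. 5 theorem, the `|H|`, `|∇H|` members).  THIS FILE: the Hölder member
`|x − x′|^{−α}|∇H_{k,μν}(x,y) − ∇H_{k,μν}(x′,y)|` from [6I] (1.111) with cut-offs `ζ ∈ C₀^∞(Δ̃(y))` (constructed), (7.2.2) at one scale with
explicit constants, Proposition 1.2 of [6I] supplied BY ITS NAME IN THE TREE (`…Balaban1983to89.B5.Ineq110_114` / `B5.Prop12Printed`), and the
typed row `…BIJ85Sect7Statements.KernelData.Ineq722` PROVED for families k ↦ (G_k, Q_k, T₁^{(k)}) with k-independent input constants.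

statement-level skeleton of published theorems with citation tags; proofs where landed; nothing here is a claim about the Yang–Mills mass gap

PDF held: `paper:balaban1985-cmp97-bij-higgs-minimizers` (journal page = PDF page + 298; p. 325 = PDF 27) and
`paper:balaban1984-cmp95-propagators-rt-i` ([6I] = [Balaban1984PropagatorsI]; journal page = PDF page + 16; pp. 33–36 = PDF 17–20); text
layers read this session.

CITATION HEADER (lean-in-tree rule).  Part of the lit-balaban TYPED SKELETON (HOME `run/shared/lean/pub/lit-balaban/`), Phase-2 seat p09 gen 4;
row **C1.Eq7.2.1-7.2.2** of `HOME/SKELETON.md` (typed `…BIJ85Sect7Statements.KernelData.Ineq722` p239582, *claim by reference to B5 Prop 1.2 /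
(1.103)*; reader file `HOME/lit-balaban-r15/ROWS-C1.md`, owner r15, referee ref-5).

THE PRINTED TEXT (verbatim, p. 325 [PDF 27]): *"The kernel H_{k,μν}(x,y) and its gradient decay exponentially. In particular there exists δ > 0
and for 0 ≤ α < 1 a constant M = M(α) < ∞ such that for |x − x′| ≤ 1, |H_{k,μν}(x,y)| + |∇H_{k,μν}(x,y)| + |x − x′|^{−α}|∇H_{k,μν}(x,y) −
∇H_{k,μν}(x′,y)| ≤ Me^{−δ|x−y|}. (7.2.2) This inequality is a consequence of Proposition 1.2 and the representation (1.103) of [6I]."*  [6I] p. 35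
[PDF 19]: *"‖A‖_α = max_μ sup_{x,x′:|x−x′|≤1} |x−x′|^{−α}|A_μ(x) − A_μ(x′)| … (1.109) … ‖ζ∇GJ‖_α, ‖ζG∇^*J‖_α ≤ O(1)e^{−δ₀|y−y′|}(‖ζ‖_α + |ζ|)|J|
(1.111) for 0 ≤ α < 1, ζ ∈ C₀^∞(Δ̃(y)), supp J ⊂ Δ̃(y′), with the constant O(1) depending on d and α (O(1) → ∞ if α → 1)"*.

WHAT IS PROVED, and how (notation of file 1: `R : Rep103`, `H`, `gradH`, `QsK`, `blockRestr`, the hypothesis bundles `Hyps γ₁ q₀ q₁ r_Q KY` and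
`Prop12Hyps C Cα δ₀`, the constants `rate1`, `rate722`, `const722`).
* §3 — the Hölder member.  Close points `0 < |x − x′| ≤ r₀` (`gradH_holder_small`): with the cut-off `ζ` of the pair (`ζ(x) = ζ(x′) = 1`,
  `supp ζ ⊂ Δ̃(ỹ)`, `‖ζ‖_α ≤ Zc`, `|ζ| ≤ 1`; clause `CutoffHyps.cutoff`), `∇H_k(x,·) − ∇H_k(x′,·) = Σ_{y′}[(ζ∇GJ_{y′})(x) − (ζ∇GJ_{y′})(x′)]`,
  each term `≤ O(1)(α)e^{−δ₀|ỹ−y′|}(Zc + 1)|J_{y′}||x − x′|^α` by (1.111), then the lattice convolution of file 1; far points `r₀ < |x − x′| ≤ 1`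
  (`gradH_holder_large`): `|∇H(x) − ∇H(x′)| ≤ |∇H(x)| + |∇H(x′)|`, `|x−x′|^{−α} ≤ r₀^{−α}`, `|y_x − y_{x′}| ≤ s₁`; together (`gradH_holder`,
  `abs_gradH_sub_le`): `|x − x′|^{−α}|∇H_k(g;p₀) − ∇H_k(g′;p₀)| ≤ holderConst(α)·e^{−δ|y_x − y_{p₀}|}`.
* §4 — **(7.2.2) at one scale** (`ineq722_core`): the three members together, `M(α) = M722 … α = 2·const722 + holderConst(α)`, `δ = rate722`,
  both functions of `(d, γ₁, q₀, q₁, O(1), O(1)(α), δ₀, KY, r₀, Zc, s₀, s₁)` only — *"there exists δ > 0 and for 0 ≤ α < 1 a constant M = M(α)"*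
  independent of k exactly when the inputs are (as [6I] states them).
* §5 — the cut-offs CONSTRUCTED (`cutoff_of_balls`: piecewise-linear profile in the distance to the centre of a ball of radius `R` inside
  `Δ̃(y)`; `r₀ = R/4`, `Zc = 4/R`), and **Proposition 1.2 by name**: the carrier `settingOf R k : B5.Setting` whose (1.110) entries n = 0, 1
  and (1.111) first entry are the genuine functionals `sup_{Δ̃(y)}|GJ|`, `sup_{Δ̃(y)}|∇GJ|`, `‖ζ∇GJ‖_α` of the kernels (the other functionals
  of the carrier are unused and set to 0), and `prop12Hyps_of_ineq110_114 : B5.Ineq110_114 (settingOf R k) C Cα Cε Cαε δ₀ → Prop12Hyps C Cα δ₀`.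
* §6 — **the typed row**: the Sect. 7.2 carrier `kernelDataOf R …` (`H_{k,μν}(x;y) := H(⟨x,μ⟩,⟨y,ν⟩)`, `|∇H| := max_λ|∇_λH|`, `|∇H(x,y) −
  ∇H(x′,y)| := max_λ|…|`, a given inter-lattice distance `|x − y|` with `|x − y| ≤ |y_x − y| + s`), (7.2.2) in `|x − y|` at one scale
  (`ineq722_kernelData`, `M = M722(α)e^{δs}`), and **`ineq722_of_family : KernelData.Ineq722 (k ↦ kernelDataOf (fam k) …)`** for every
  family with k-independent `Hyps`/`Prop12Hyps`/`CutoffHyps` constants; **`ineq722_of_prop12Printed`**: the same from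
  `B5.Prop12Printed (k ↦ settingOf (fam k) k)` — *"(7.2.2) is a consequence of Proposition 1.2 and the representation (1.103)"* with Prop. 1.2
  entering by its name in the tree.
HONEST SCOPE.  As in file 1: Proposition 1.2 of [6I] (row B5.Prop1.2, typed `B5.Prop12Printed`, NOT proved in the tree), (1.100)–(1.101),
the symmetry clause of Prop. 1.1, the structural facts about `Q`, `Q^*`, the cubes and the lattice geometry (`Hyps`, `CutoffHyps`, `|x − y| ≤
|y_x − y| + s`, `|x − x′| > 0` for `x ≠ x′`) are HYPOTHESES OF THE PRINTED SHAPE, to be discharged by the instantiator on a concrete torus; the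
[7] Sect. 5 theorem, the lattice convolution and the cut-offs are proved.  No new Prop-valued fact beyond the hypothesis bundle `CutoffHyps`;
nothing of the paper is asserted beyond the kernel-checked statements below.  Unit `lit-balaban-p09` (literature-prover-lit-balaban-p09-g4-0),
2026-08-21.
-/

namespace Literature.MathematicalPhysics.QuantumFieldTheory.BalabanImbrieJaffe1984to88.BIJ85Ineq722ProofPart2

open Literature.MathematicalPhysics.QuantumFieldTheory.Balaban1983to89
open scoped BigOperators Matrix
open BIJ85Ineq722Proof BIJ85Ineq722Proof.Rep103

noncomputable section

variable {R : Rep103} {C δ₀ γ₁ q₀ q₁ rQ : ℝ} {KY : ℝ → ℝ} {Cα : ℝ → ℝ}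

/-! ## §3  The Hölder member of (7.2.2), `|x − x′|^{−α}|∇H_{k,μν}(x, y) − ∇H_{k,μν}(x′, y)|`, from (1.111) -/

/-- The cut-off functions used with (1.111) and the cube geometry behind them, at geometric constants `(r₀, Zc, s₀, s₁)`:
* `cutoff` — for `|x − x′| ≤ r₀` a `ζ ∈ C₀^∞(Δ̃(y))` (on the lattice: `supp ζ ⊂ Δ̃(y)`) with `ζ(x) = ζ(x′) = 1`, `|ζ| ≤ 1`, `‖ζ‖_α ≤ Zc`
  for all `0 ≤ α < 1`, and `|y_x − y| ≤ s₀` (constructed from round balls inside the cubes in `cutoff_of_balls`);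
* `near` — `|x − x′| ≤ 1 ⇒ |y_x − y_{x′}| ≤ s₁` (neighbouring fine points lie in neighbouring blocks).
[cite: BalabanImbrieJaffe1985, (7.2.2) p.325] -/
structure CutoffHyps (R : Rep103) (r₀ Zc s₀ s₁ : ℝ) : Prop where
  r₀_pos : 0 < r₀
  r₀_le_one : r₀ ≤ 1
  Zc_nonneg : 0 ≤ Zc
  s₀_nonneg : 0 ≤ s₀
  s₁_nonneg : 0 ≤ s₁
  cutoff : ∀ x x' : R.S, R.dS x x' ≤ r₀ → ∃ (y : R.Y) (ζ : R.S → ℝ), (∀ z, ζ z ≠ 0 → z ∈ R.cube y) ∧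
      ζ x = 1 ∧ ζ x' = 1 ∧ (∀ z, |ζ z| ≤ 1) ∧
      (∀ α : ℝ, 0 ≤ α → α < 1 → ∀ z z', 0 < R.dS z z' → R.dS z z' ≤ 1 → |ζ z - ζ z'| ≤ Zc * R.dS z z' ^ α) ∧
      R.dY (R.blk x) y ≤ s₀
  near : ∀ x x' : R.S, R.dS x x' ≤ 1 → R.dY (R.blk x) (R.blk x') ≤ s₁

variable {r₀ Zc s₀ s₁ : ℝ}

/-- The Hölder constant `M(α)` of (7.2.2) produced by the derivation: a function of `(d, γ₁, q₀, q₁, O(1), O(1)(α), δ₀, KY, r₀, Zc, s₀, s₁)`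
only — *"for 0 ≤ α < 1 a constant M = M(α) < ∞"*, independent of k. [cite: BalabanImbrieJaffe1985, (7.2.2) p.325] -/
def holderConst (nD : ℕ) (C δ₀ γ₁ q₀ q₁ rQ : ℝ) (KY : ℝ → ℝ) (Cα : ℝ → ℝ) (r₀ Zc s₀ s₁ α : ℝ) : ℝ :=
  max (Cα α) 0 * (Zc + 1) * (q₀ * Real.exp (rate1 nD C δ₀ γ₁ q₀ q₁ rQ KY * rQ) * (2 / γ₁)) *
      KY (rate722 nD C δ₀ γ₁ q₀ q₁ rQ KY) * Real.exp (rate722 nD C δ₀ γ₁ q₀ q₁ rQ KY * s₀) +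
    const722 nD C δ₀ γ₁ q₀ q₁ rQ KY * (1 + Real.exp (rate722 nD C δ₀ γ₁ q₀ q₁ rQ KY * s₁)) * r₀ ^ (-α)

/-- `M(α) ≥ 0`. [cite: BalabanImbrieJaffe1985, (7.2.2) p.325] -/
theorem holderConst_nonneg (h : R.Hyps γ₁ q₀ q₁ rQ KY) (h12 : R.Prop12Hyps C Cα δ₀) (hc : CutoffHyps R r₀ Zc s₀ s₁) (nD : ℕ) (α : ℝ) :
    0 ≤ holderConst nD C δ₀ γ₁ q₀ q₁ rQ KY Cα r₀ Zc s₀ s₁ α := by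
  unfold holderConst
  have := h.q₀_nonneg; have := h.γ₁_pos; have := hc.Zc_nonneg; have := hc.r₀_pos
  have := h.KY_nonneg _ (rate722_pos h h12 nD); have := const722_nonneg h h12 nD
  have : 0 ≤ max (Cα α) 0 := le_max_right _ _
  have : 0 ≤ r₀ ^ (-α) := Real.rpow_nonneg hc.r₀_pos.le _
  positivity

/-- moving the centre of an exponential weight by a bounded amount costs a factor `e^{δs}`. [folklore] -/
private theorem exp_shift {δ a b s : ℝ} (hδ : 0 ≤ δ) (hab : a ≤ s + b) :
    Real.exp (-(δ * b)) ≤ Real.exp (δ * s) * Real.exp (-(δ * a)) := by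
  rw [← Real.exp_add]
  apply Real.exp_le_exp.2
  nlinarith [mul_le_mul_of_nonneg_left hab hδ]

/-- **The Hölder member for close points** (`0 < |x − x′| ≤ r₀`): with the cut-off `ζ` of the pair (`ζ(x) = ζ(x′) = 1`),
`∇H(x,·) − ∇H(x′,·) = Σ_{y′}[(ζ∇GJ_{y′})(x) − (ζ∇GJ_{y′})(x′)]`, each term bounded by (1.111), then the lattice convolution.
[cite: BalabanImbrieJaffe1985, (7.2.2) p.325] -/
theorem gradH_holder_small (h : R.Hyps γ₁ q₀ q₁ rQ KY) (h12 : R.Prop12Hyps C Cα δ₀) (hc : CutoffHyps R r₀ Zc s₀ s₁) {α : ℝ} (hα0 : 0 ≤ α)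
    (hα1 : α < 1) (g g' : R.ιg) (hcomp : g.2 = g'.2) (hpos : 0 < R.dS g.1 g'.1) (hle : R.dS g.1 g'.1 ≤ r₀) (p₀ : R.κ) :
    |R.gradH g p₀ - R.gradH g' p₀| ≤
      max (Cα α) 0 * (Zc + 1) * (q₀ * Real.exp (rate1 (Fintype.card R.Dir) C δ₀ γ₁ q₀ q₁ rQ KY * rQ) * (2 / γ₁)) *
        KY (rate722 (Fintype.card R.Dir) C δ₀ γ₁ q₀ q₁ rQ KY) *
        Real.exp (rate722 (Fintype.card R.Dir) C δ₀ γ₁ q₀ q₁ rQ KY * s₀) *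
        Real.exp (-(rate722 (Fintype.card R.Dir) C δ₀ γ₁ q₀ q₁ rQ KY * R.dY (R.blk g.1) p₀.1)) * R.dS g.1 g'.1 ^ α := by
  set δ₁ := rate1 (Fintype.card R.Dir) C δ₀ γ₁ q₀ q₁ rQ KY with hδ₁
  have hδ : rate722 (Fintype.card R.Dir) C δ₀ γ₁ q₀ q₁ rQ KY = δ₁ / 2 := by simp only [rate722, hδ₁]
  rw [hδ]
  obtain ⟨y, ζ, hsupp, hx, hx', hζ1, hζh, hy⟩ := hc.cutoff g.1 g'.1 hle
  have hle1 : R.dS g.1 g'.1 ≤ 1 := hle.trans hc.r₀_le_one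
  set A : ℝ := max (Cα α) 0 * (Zc + 1) * R.dS g.1 g'.1 ^ α with hA
  have hA0 : 0 ≤ A := by
    rw [hA]; have := hc.Zc_nonneg; have : 0 ≤ max (Cα α) 0 := le_max_right _ _
    have : 0 ≤ R.dS g.1 g'.1 ^ α := Real.rpow_nonneg (h.dS_nonneg _ _) _
    positivity
  set Aq : ℝ := q₀ * Real.exp (δ₁ * rQ) * (2 / γ₁) with hAq
  have hAq0 : 0 ≤ Aq := by rw [hAq]; have := h.q₀_nonneg; have := h.γ₁_pos; positivity
  -- the blocks J_{y′} = (Q^*(QGQ^*)⁻¹δ_{p₀})1_{Δ(y′)} and each term of the y′-sum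
  have hterm : ∀ y', |(R.DG *ᵥ R.blockRestr (R.QsK p₀) y') g - (R.DG *ᵥ R.blockRestr (R.QsK p₀) y') g'| ≤
      A * Aq * (Real.exp (-(δ₀ * R.dY y y')) * Real.exp (-(δ₁ * R.dY y' p₀.1))) := by
    intro y'
    have h1 := h12.h111 α (R.blockRestr (R.QsK p₀) y') ζ y y' Zc 1 hα0 hα1 hc.Zc_nonneg zero_le_one hsupp
      (blockRestr_supp h (R.QsK p₀) y') (hζh α hα0 hα1) hζ1 g g' hcomp hpos hle1
    rw [hx, hx', one_mul, one_mul] at h1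
    have h2 := norm_blockRestr_QsK_le h h12 p₀ y'
    rw [← hδ₁] at h2
    have h3 : 0 ≤ max (Cα α) 0 * Real.exp (-(δ₀ * R.dY y y')) * (Zc + 1) * R.dS g.1 g'.1 ^ α := by
      have := hc.Zc_nonneg; have : 0 ≤ max (Cα α) 0 := le_max_right _ _
      have : 0 ≤ R.dS g.1 g'.1 ^ α := Real.rpow_nonneg (h.dS_nonneg _ _) _
      positivity
    calc |(R.DG *ᵥ R.blockRestr (R.QsK p₀) y') g - (R.DG *ᵥ R.blockRestr (R.QsK p₀) y') g'|
        ≤ max (Cα α) 0 * Real.exp (-(δ₀ * R.dY y y')) * (Zc + 1) * ‖R.blockRestr (R.QsK p₀) y'‖ * R.dS g.1 g'.1 ^ α := h1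
      _ = max (Cα α) 0 * Real.exp (-(δ₀ * R.dY y y')) * (Zc + 1) * R.dS g.1 g'.1 ^ α * ‖R.blockRestr (R.QsK p₀) y'‖ := by
          ring
      _ ≤ max (Cα α) 0 * Real.exp (-(δ₀ * R.dY y y')) * (Zc + 1) * R.dS g.1 g'.1 ^ α *
            (q₀ * Real.exp (δ₁ * rQ) * (2 / γ₁) * Real.exp (-(δ₁ * R.dY y' p₀.1))) := mul_le_mul_of_nonneg_left h2 h3
      _ = _ := by rw [hA, hAq]; ring
  have hsum : R.gradH g p₀ - R.gradH g' p₀ =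
      ∑ y', ((R.DG *ᵥ R.blockRestr (R.QsK p₀) y') g - (R.DG *ᵥ R.blockRestr (R.QsK p₀) y') g') := by
    rw [Finset.sum_sub_distrib, gradH_apply, gradH_apply]
    conv_lhs => rw [← sum_blockRestr (R.QsK p₀)]
    rw [Matrix.mulVec_sum, Finset.sum_apply, Finset.sum_apply]
  have hq : 0 ≤ A * Aq := mul_nonneg hA0 hAq0
  have hshift : Real.exp (-(δ₁ / 2 * R.dY y p₀.1)) ≤
      Real.exp (δ₁ / 2 * s₀) * Real.exp (-(δ₁ / 2 * R.dY (R.blk g.1) p₀.1)) := by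
    apply exp_shift (by have := rate1_pos h h12 (Fintype.card R.Dir); rw [← hδ₁] at this; linarith)
    have := h.dY_pd.triangle (R.blk g.1) y p₀.1
    linarith
  have hKY : 0 ≤ KY (δ₁ / 2) := h.KY_nonneg _ (by have := rate1_pos h h12 (Fintype.card R.Dir); rw [← hδ₁] at this; linarith)
  rw [hsum]
  calc |∑ y', ((R.DG *ᵥ R.blockRestr (R.QsK p₀) y') g - (R.DG *ᵥ R.blockRestr (R.QsK p₀) y') g')|
      ≤ ∑ y', |(R.DG *ᵥ R.blockRestr (R.QsK p₀) y') g - (R.DG *ᵥ R.blockRestr (R.QsK p₀) y') g'| :=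
        Finset.abs_sum_le_sum_abs _ _
    _ ≤ ∑ y', A * Aq * (Real.exp (-(δ₀ * R.dY y y')) * Real.exp (-(δ₁ * R.dY y' p₀.1))) :=
        Finset.sum_le_sum fun y' _ => hterm y'
    _ = A * Aq * ∑ y', Real.exp (-(δ₀ * R.dY y y')) * Real.exp (-(δ₁ * R.dY y' p₀.1)) := by
        rw [Finset.mul_sum]
    _ ≤ A * Aq * (KY (δ₁ / 2) * Real.exp (-(δ₁ / 2 * R.dY y p₀.1))) :=
        mul_le_mul_of_nonneg_left (conv_exp_le h.dY_pd h.sumY (rate1_pos h h12 _) (rate1_le_δ₀ h12 _ _ _ _ _ _) _ _) hq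
    _ ≤ A * Aq * (KY (δ₁ / 2) *
          (Real.exp (δ₁ / 2 * s₀) * Real.exp (-(δ₁ / 2 * R.dY (R.blk g.1) p₀.1)))) :=
        mul_le_mul_of_nonneg_left (mul_le_mul_of_nonneg_left hshift hKY) hq
    _ = _ := by rw [hA, hAq]; ring

/-- **The Hölder member for points at distance `r₀ < |x − x′| ≤ 1`**: the trivial bound `|∇H(x) − ∇H(x′)| ≤ |∇H(x)| + |∇H(x′)|` with the
`|∇H|` member, `|x − x′|^{−α} ≤ r₀^{−α}`, and `|y_x − y_{x′}| ≤ s₁`. [cite: BalabanImbrieJaffe1985, (7.2.2) p.325] -/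
theorem gradH_holder_large (h : R.Hyps γ₁ q₀ q₁ rQ KY) (h12 : R.Prop12Hyps C Cα δ₀) (hc : CutoffHyps R r₀ Zc s₀ s₁) {α : ℝ} (hα0 : 0 ≤ α)
    (g g' : R.ιg) (hgt : r₀ < R.dS g.1 g'.1) (hle1 : R.dS g.1 g'.1 ≤ 1) (p₀ : R.κ) :
    |R.gradH g p₀ - R.gradH g' p₀| ≤
      const722 (Fintype.card R.Dir) C δ₀ γ₁ q₀ q₁ rQ KY * (1 + Real.exp (rate722 (Fintype.card R.Dir) C δ₀ γ₁ q₀ q₁ rQ KY * s₁)) *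
        r₀ ^ (-α) * Real.exp (-(rate722 (Fintype.card R.Dir) C δ₀ γ₁ q₀ q₁ rQ KY * R.dY (R.blk g.1) p₀.1)) * R.dS g.1 g'.1 ^ α := by
  set δ := rate722 (Fintype.card R.Dir) C δ₀ γ₁ q₀ q₁ rQ KY with hδ
  set A₀ := const722 (Fintype.card R.Dir) C δ₀ γ₁ q₀ q₁ rQ KY with hA₀
  have hδ0 : 0 ≤ δ := (rate722_pos h h12 _).le
  have hA0 : 0 ≤ A₀ := const722_nonneg h h12 _
  have h1 := abs_gradH_le h h12 g p₀
  have h2 := abs_gradH_le h h12 g' p₀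
  rw [← hδ, ← hA₀] at h1 h2
  have hshift : Real.exp (-(δ * R.dY (R.blk g'.1) p₀.1)) ≤
      Real.exp (δ * s₁) * Real.exp (-(δ * R.dY (R.blk g.1) p₀.1)) := by
    apply exp_shift hδ0
    have := h.dY_pd.triangle (R.blk g.1) (R.blk g'.1) p₀.1
    have := hc.near g.1 g'.1 hle1
    linarith
  -- |x − x′|^{−α}: 1 ≤ r₀^{−α}|x − x′|^α
  have hr : 1 ≤ r₀ ^ (-α) * R.dS g.1 g'.1 ^ α := by
    have hr0 := hc.r₀_pos
    have e1 : r₀ ^ (-α) * r₀ ^ α = 1 := by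
      rw [Real.rpow_neg hr0.le, inv_mul_cancel₀ (Real.rpow_pos_of_pos hr0 α).ne']
    rw [← e1]
    exact mul_le_mul_of_nonneg_left (Real.rpow_le_rpow hr0.le hgt.le hα0) (Real.rpow_nonneg hr0.le _)
  have hE : 0 ≤ A₀ * (1 + Real.exp (δ * s₁)) * Real.exp (-(δ * R.dY (R.blk g.1) p₀.1)) := by positivity
  calc |R.gradH g p₀ - R.gradH g' p₀| ≤ |R.gradH g p₀| + |R.gradH g' p₀| := abs_sub _ _
    _ ≤ A₀ * Real.exp (-(δ * R.dY (R.blk g.1) p₀.1)) + A₀ * Real.exp (-(δ * R.dY (R.blk g'.1) p₀.1)) := add_le_add h1 h2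
    _ ≤ A₀ * Real.exp (-(δ * R.dY (R.blk g.1) p₀.1)) +
          A₀ * (Real.exp (δ * s₁) * Real.exp (-(δ * R.dY (R.blk g.1) p₀.1))) :=
        add_le_add le_rfl (mul_le_mul_of_nonneg_left hshift hA0)
    _ = A₀ * (1 + Real.exp (δ * s₁)) * Real.exp (-(δ * R.dY (R.blk g.1) p₀.1)) * 1 := by ring
    _ ≤ A₀ * (1 + Real.exp (δ * s₁)) * Real.exp (-(δ * R.dY (R.blk g.1) p₀.1)) * (r₀ ^ (-α) * R.dS g.1 g'.1 ^ α) :=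
        mul_le_mul_of_nonneg_left hr hE
    _ = _ := by ring

/-- **The Hölder member of (7.2.2)**: for gradient indices `g = (x, λ, μ)`, `g′ = (x′, λ, μ)` with `0 < |x − x′| ≤ 1`,
`|x − x′|^{−α}|∇H_k(g; p₀) − ∇H_k(g′; p₀)| ≤ M(α)e^{−δ|y_x − y_{p₀}|}`. [cite: BalabanImbrieJaffe1985, (7.2.2) p.325] -/
theorem gradH_holder (h : R.Hyps γ₁ q₀ q₁ rQ KY) (h12 : R.Prop12Hyps C Cα δ₀) (hc : CutoffHyps R r₀ Zc s₀ s₁) {α : ℝ} (hα0 : 0 ≤ α)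
    (hα1 : α < 1) (g g' : R.ιg) (hcomp : g.2 = g'.2) (hpos : 0 < R.dS g.1 g'.1) (hle1 : R.dS g.1 g'.1 ≤ 1) (p₀ : R.κ) :
    R.dS g.1 g'.1 ^ (-α) * |R.gradH g p₀ - R.gradH g' p₀| ≤
      holderConst (Fintype.card R.Dir) C δ₀ γ₁ q₀ q₁ rQ KY Cα r₀ Zc s₀ s₁ α *
        Real.exp (-(rate722 (Fintype.card R.Dir) C δ₀ γ₁ q₀ q₁ rQ KY * R.dY (R.blk g.1) p₀.1)) := by
  set δ := rate722 (Fintype.card R.Dir) C δ₀ γ₁ q₀ q₁ rQ KY with hδ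
  set E := Real.exp (-(δ * R.dY (R.blk g.1) p₀.1)) with hE
  set B₁ := max (Cα α) 0 * (Zc + 1) * (q₀ * Real.exp (rate1 (Fintype.card R.Dir) C δ₀ γ₁ q₀ q₁ rQ KY * rQ) * (2 / γ₁)) *
      KY δ * Real.exp (δ * s₀) with hB₁
  set B₂ := const722 (Fintype.card R.Dir) C δ₀ γ₁ q₀ q₁ rQ KY * (1 + Real.exp (δ * s₁)) * r₀ ^ (-α) with hB₂
  have hB₁0 : 0 ≤ B₁ := by
    rw [hB₁]; have := h.q₀_nonneg; have := h.γ₁_pos; have := hc.Zc_nonneg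
    have := h.KY_nonneg _ (rate722_pos h h12 (Fintype.card R.Dir)); rw [← hδ] at this
    have : 0 ≤ max (Cα α) 0 := le_max_right _ _
    positivity
  have hB₂0 : 0 ≤ B₂ := by
    rw [hB₂]; have := const722_nonneg h h12 (Fintype.card R.Dir); have := hc.r₀_pos
    have : 0 ≤ r₀ ^ (-α) := Real.rpow_nonneg hc.r₀_pos.le _
    positivity
  have hconst : holderConst (Fintype.card R.Dir) C δ₀ γ₁ q₀ q₁ rQ KY Cα r₀ Zc s₀ s₁ α = B₁ + B₂ := by
    simp only [holderConst, hB₁, hB₂, hδ]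
  have hd0 : 0 ≤ R.dS g.1 g'.1 ^ α := Real.rpow_nonneg (h.dS_nonneg _ _) _
  have hE0 : 0 ≤ E := (Real.exp_pos _).le
  -- in both cases: |∇H(g) − ∇H(g′)| ≤ (B₁ + B₂)·E·|x − x′|^α
  have hboth : |R.gradH g p₀ - R.gradH g' p₀| ≤ (B₁ + B₂) * E * R.dS g.1 g'.1 ^ α := by
    by_cases hsm : R.dS g.1 g'.1 ≤ r₀
    · have h1 := gradH_holder_small h h12 hc hα0 hα1 g g' hcomp hpos hsm p₀
      rw [← hδ, ← hE] at h1
      calc |R.gradH g p₀ - R.gradH g' p₀| ≤ B₁ * E * R.dS g.1 g'.1 ^ α := by rw [hB₁]; exact h1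
        _ ≤ (B₁ + B₂) * E * R.dS g.1 g'.1 ^ α := by
            apply mul_le_mul_of_nonneg_right _ hd0
            exact mul_le_mul_of_nonneg_right (by linarith) hE0
    · have h1 := gradH_holder_large h h12 hc hα0 g g' (lt_of_not_ge hsm) hle1 p₀
      rw [← hδ, ← hE] at h1
      calc |R.gradH g p₀ - R.gradH g' p₀| ≤ B₂ * E * R.dS g.1 g'.1 ^ α := by rw [hB₂]; exact h1
        _ ≤ (B₁ + B₂) * E * R.dS g.1 g'.1 ^ α := by
            apply mul_le_mul_of_nonneg_right _ hd0
            exact mul_le_mul_of_nonneg_right (by linarith) hE0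
  have hcancel : R.dS g.1 g'.1 ^ (-α) * R.dS g.1 g'.1 ^ α = 1 := by
    rw [Real.rpow_neg (h.dS_nonneg _ _), inv_mul_cancel₀ (Real.rpow_pos_of_pos hpos α).ne']
  rw [hconst]
  calc R.dS g.1 g'.1 ^ (-α) * |R.gradH g p₀ - R.gradH g' p₀|
      ≤ R.dS g.1 g'.1 ^ (-α) * ((B₁ + B₂) * E * R.dS g.1 g'.1 ^ α) :=
        mul_le_mul_of_nonneg_left hboth (Real.rpow_nonneg (h.dS_nonneg _ _) _)
    _ = (B₁ + B₂) * E * (R.dS g.1 g'.1 ^ (-α) * R.dS g.1 g'.1 ^ α) := by ring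
    _ = (B₁ + B₂) * E := by rw [hcancel, mul_one]

/-! ## §4  (7.2.2) at one scale -/

/-- The constant `M = M(α)` of (7.2.2) produced by the derivation (`|H|`, `|∇H|` and Hölder members together); a function of
`(d, γ₁, q₀, q₁, O(1), O(1)(α), δ₀, KY, r₀, Zc, s₀, s₁)` and `α` only. [cite: BalabanImbrieJaffe1985, (7.2.2) p.325] -/
def M722 (nD : ℕ) (C δ₀ γ₁ q₀ q₁ rQ : ℝ) (KY : ℝ → ℝ) (Cα : ℝ → ℝ) (r₀ Zc s₀ s₁ α : ℝ) : ℝ :=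
  2 * const722 nD C δ₀ γ₁ q₀ q₁ rQ KY + holderConst nD C δ₀ γ₁ q₀ q₁ rQ KY Cα r₀ Zc s₀ s₁ α

/-- **(7.2.2) at one scale**, p. 325 [PDF 27], verbatim: *"there exists δ > 0 and for 0 ≤ α < 1 a constant M = M(α) < ∞ such that for
|x − x′| ≤ 1, |H_{k,μν}(x,y)| + |∇H_{k,μν}(x,y)| + |x − x′|^{−α}|∇H_{k,μν}(x,y) − ∇H_{k,μν}(x′,y)| ≤ Me^{−δ|x−y|}. (7.2.2) This
inequality is a consequence of Proposition 1.2 and the representation (1.103) of [6I]."* — PROVED for the kernel `H_k = GQ^*(QGQ^*)⁻¹`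
of (1.103) and its gradient kernel, component `λ` of the gradient, from the inputs `Hyps`/`HolderHyps` (Prop. 1.2 (1.110)–(1.111),
(1.100), Prop. 1.1 symmetry, the averaging operators and the cube geometry), with `δ = rate722 …`, `M = M722 … α` functions of the
input constants only and the decay measured in the unit-lattice distance `|y_x − y|` from the block of `x` (the passage to `|x − y|`
is `ineq722_of_family` below). [cite: BalabanImbrieJaffe1985, (7.2.2) p.325] -/
theorem ineq722_core (h : R.Hyps γ₁ q₀ q₁ rQ KY) (h12 : R.Prop12Hyps C Cα δ₀) (hc : CutoffHyps R r₀ Zc s₀ s₁) {α : ℝ} (hα0 : 0 ≤ α)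
    (hα1 : α < 1) (x x' : R.S) (lam μ ν : R.Dir) (y : R.Y) (hpos : 0 < R.dS x x') (hle1 : R.dS x x' ≤ 1) :
    |R.H (x, μ) (y, ν)| + |R.gradH (x, lam, μ) (y, ν)| +
        R.dS x x' ^ (-α) * |R.gradH (x, lam, μ) (y, ν) - R.gradH (x', lam, μ) (y, ν)| ≤
      M722 (Fintype.card R.Dir) C δ₀ γ₁ q₀ q₁ rQ KY Cα r₀ Zc s₀ s₁ α *
        Real.exp (-(rate722 (Fintype.card R.Dir) C δ₀ γ₁ q₀ q₁ rQ KY * R.dY (R.blk x) y)) := by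
  have h1 := abs_H_le h h12 (x, μ) (y, ν)
  have h2 := abs_gradH_le h h12 (x, lam, μ) (y, ν)
  have h3 := gradH_holder h h12 hc hα0 hα1 (x, lam, μ) (x', lam, μ) rfl hpos hle1 (y, ν)
  unfold M722
  linarith

/-- corollary of the Hölder member in product form: `|∇H_k(g; p₀) − ∇H_k(g′; p₀)| ≤ M(α)e^{−δ|y_x − y_{p₀}|}|x − x′|^α`.
[cite: BalabanImbrieJaffe1985, (7.2.2) p.325] -/
theorem abs_gradH_sub_le (h : R.Hyps γ₁ q₀ q₁ rQ KY) (h12 : R.Prop12Hyps C Cα δ₀) (hc : CutoffHyps R r₀ Zc s₀ s₁) {α : ℝ}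
    (hα0 : 0 ≤ α) (hα1 : α < 1) (g g' : R.ιg) (hcomp : g.2 = g'.2) (hpos : 0 < R.dS g.1 g'.1) (hle1 : R.dS g.1 g'.1 ≤ 1)
    (p₀ : R.κ) :
    |R.gradH g p₀ - R.gradH g' p₀| ≤
      holderConst (Fintype.card R.Dir) C δ₀ γ₁ q₀ q₁ rQ KY Cα r₀ Zc s₀ s₁ α *
        Real.exp (-(rate722 (Fintype.card R.Dir) C δ₀ γ₁ q₀ q₁ rQ KY * R.dY (R.blk g.1) p₀.1)) * R.dS g.1 g'.1 ^ α := by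
  have h1 := gradH_holder h h12 hc hα0 hα1 g g' hcomp hpos hle1 p₀
  have hd : 0 < R.dS g.1 g'.1 ^ α := Real.rpow_pos_of_pos hpos α
  have hcancel : R.dS g.1 g'.1 ^ α * R.dS g.1 g'.1 ^ (-α) = 1 := by
    rw [Real.rpow_neg (h.dS_nonneg _ _), mul_inv_cancel₀ hd.ne']
  calc |R.gradH g p₀ - R.gradH g' p₀|
      = R.dS g.1 g'.1 ^ α * (R.dS g.1 g'.1 ^ (-α) * |R.gradH g p₀ - R.gradH g' p₀|) := by
        rw [← mul_assoc, hcancel, one_mul]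
    _ ≤ R.dS g.1 g'.1 ^ α * (holderConst (Fintype.card R.Dir) C δ₀ γ₁ q₀ q₁ rQ KY Cα r₀ Zc s₀ s₁ α *
          Real.exp (-(rate722 (Fintype.card R.Dir) C δ₀ γ₁ q₀ q₁ rQ KY * R.dY (R.blk g.1) p₀.1))) :=
        mul_le_mul_of_nonneg_left h1 hd.le
    _ = _ := by ring

/-! ## §5  The cut-offs from the cube geometry; Proposition 1.2 as typed in the tree (`B5.Ineq110_114`) supplies `Prop12Hyps` -/

/-- the profile `t ↦ max{0, min{1, t}}` of the piecewise-linear cut-offs. [folklore] -/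
def clamp01 (t : ℝ) : ℝ := max 0 (min 1 t)

/-- `0 ≤ clamp01 t`. [folklore] -/
private theorem clamp01_nonneg (t : ℝ) : 0 ≤ clamp01 t := le_max_left _ _

/-- `clamp01 t ≤ 1`. [folklore] -/
private theorem clamp01_le_one (t : ℝ) : clamp01 t ≤ 1 := max_le zero_le_one (min_le_left _ _)

/-- `|clamp01 t| ≤ 1`. [folklore] -/
private theorem abs_clamp01_le (t : ℝ) : |clamp01 t| ≤ 1 := by
  rw [abs_of_nonneg (clamp01_nonneg t)]; exact clamp01_le_one t

/-- `clamp01 t = 1` for `t ≥ 1`. [folklore] -/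
private theorem clamp01_eq_one {t : ℝ} (ht : 1 ≤ t) : clamp01 t = 1 := by
  unfold clamp01; rw [min_eq_left ht, max_eq_right zero_le_one]

/-- `clamp01 t = 0` for `t ≤ 0`. [folklore] -/
private theorem clamp01_eq_zero {t : ℝ} (ht : t ≤ 0) : clamp01 t = 0 := by
  unfold clamp01; rw [max_eq_left]; exact (min_le_right _ _).trans ht

/-- `clamp01` is 1-Lipschitz. [folklore] -/
private theorem abs_clamp01_sub_le (a b : ℝ) : |clamp01 a - clamp01 b| ≤ |a - b| := by
  unfold clamp01
  have h2 : |max 0 (min 1 a) - max 0 (min 1 b)| ≤ |min 1 a - min 1 b| :=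
    (abs_max_sub_max_le_max (0 : ℝ) (min 1 a) 0 (min 1 b)).trans
      (max_le (by rw [sub_self, abs_zero]; exact abs_nonneg _) le_rfl)
  have h1 : |min 1 a - min 1 b| ≤ |a - b| :=
    (abs_min_sub_min_le_max (1 : ℝ) a 1 b).trans
      (max_le (by rw [sub_self, abs_zero]; exact abs_nonneg _) le_rfl)
  exact h2.trans h1

/-- **Construction of the cut-offs** used with (1.111) (the clause `CutoffHyps.cutoff` with `r₀ = R/4`, `Zc = 4/R`): if every doubled cube
`Δ̃(y)` contains the open ball of radius `R` of `|·|` around a point `c_y`, and every fine point `x` lies within `R/2` of some `c_y` with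
`|y_x − y| ≤ s₀` (for the cubes of [6I] p. 35 — `Δ̃(y)` = the cube of side 2 centred at the unit-lattice point `y`, `R = 1`, `c_y = y`,
`y` = the corner of `Δ(y_x) ∋ x` nearest to `x`), then for `|x − x′| ≤ R/4` the piecewise-linear `ζ(z) = max{0, min{1, (4/R)(R −
|z − c_y|)}}` is supported in `Δ̃(y)`, equals 1 at `x` and `x′`, `|ζ| ≤ 1`, and `‖ζ‖_α ≤ 4/R` for every `α ≤ 1` — an admissible `ζ ∈ C₀^∞(Δ̃(y))`
of (1.111) on the lattice. [cite: Balaban1984PropagatorsI, (1.111) p.35] -/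
theorem cutoff_of_balls (hdS : B4Sect5Torus.IsPseudoDist R.dS) (ctr : R.Y → R.S) {Rr s₀ : ℝ} (hR : 0 < Rr)
    (hball : ∀ (y : R.Y) (z : R.S), R.dS z (ctr y) < Rr → z ∈ R.cube y)
    (hctr : ∀ x : R.S, ∃ y : R.Y, R.dS x (ctr y) ≤ Rr / 2 ∧ R.dY (R.blk x) y ≤ s₀)
    (x x' : R.S) (hxx' : R.dS x x' ≤ Rr / 4) :
    ∃ (y : R.Y) (ζ : R.S → ℝ), (∀ z, ζ z ≠ 0 → z ∈ R.cube y) ∧ ζ x = 1 ∧ ζ x' = 1 ∧ (∀ z, |ζ z| ≤ 1) ∧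
      (∀ α : ℝ, 0 ≤ α → α < 1 → ∀ z z', 0 < R.dS z z' → R.dS z z' ≤ 1 →
        |ζ z - ζ z'| ≤ (4 / Rr) * R.dS z z' ^ α) ∧
      R.dY (R.blk x) y ≤ s₀ := by
  obtain ⟨y, hxc, hy⟩ := hctr x
  have h4 : 0 < 4 / Rr := by positivity
  refine ⟨y, fun z => clamp01 (4 / Rr * (Rr - R.dS z (ctr y))), ?_, ?_, ?_, ?_, ?_, hy⟩
  · intro z hz
    apply hball y z
    by_contra hge
    apply hz
    apply clamp01_eq_zero
    have : Rr - R.dS z (ctr y) ≤ 0 := by linarith [not_lt.1 hge]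
    exact mul_nonpos_of_nonneg_of_nonpos h4.le this
  · apply clamp01_eq_one
    have h1 : Rr / 2 ≤ Rr - R.dS x (ctr y) := by linarith
    have h2 : 4 / Rr * (Rr / 2) = 2 := by field_simp; ring
    calc (1 : ℝ) ≤ 2 := by norm_num
      _ = 4 / Rr * (Rr / 2) := h2.symm
      _ ≤ 4 / Rr * (Rr - R.dS x (ctr y)) := mul_le_mul_of_nonneg_left h1 h4.le
  · apply clamp01_eq_one
    have h0 : R.dS x' (ctr y) ≤ R.dS x' x + R.dS x (ctr y) := hdS.triangle _ _ _
    rw [hdS.symm x' x] at h0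
    have h1 : Rr / 4 ≤ Rr - R.dS x' (ctr y) := by linarith
    have h2 : 4 / Rr * (Rr / 4) = 1 := by field_simp
    calc (1 : ℝ) = 4 / Rr * (Rr / 4) := h2.symm
      _ ≤ 4 / Rr * (Rr - R.dS x' (ctr y)) := mul_le_mul_of_nonneg_left h1 h4.le
  · intro z; exact abs_clamp01_le _
  · intro α _ hα1 z z' hpos hle1
    have htri : |R.dS z' (ctr y) - R.dS z (ctr y)| ≤ R.dS z z' := by
      rw [abs_sub_le_iff]
      constructor
      · have := hdS.triangle z' z (ctr y); rw [hdS.symm z' z] at this; linarith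
      · have := hdS.triangle z z' (ctr y); linarith
    have hpow : R.dS z z' ≤ R.dS z z' ^ α := by
      have := Real.rpow_le_rpow_of_exponent_ge hpos hle1 hα1.le
      rwa [Real.rpow_one] at this
    calc |clamp01 (4 / Rr * (Rr - R.dS z (ctr y))) - clamp01 (4 / Rr * (Rr - R.dS z' (ctr y)))|
        ≤ |4 / Rr * (Rr - R.dS z (ctr y)) - 4 / Rr * (Rr - R.dS z' (ctr y))| := abs_clamp01_sub_le _ _
      _ = 4 / Rr * |R.dS z' (ctr y) - R.dS z (ctr y)| := by
          rw [← mul_sub, abs_mul, abs_of_pos h4]; congr 1; ring_nf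
      _ ≤ 4 / Rr * R.dS z z' := mul_le_mul_of_nonneg_left htri h4.le
      _ ≤ 4 / Rr * R.dS z z' ^ α := mul_le_mul_of_nonneg_left hpow h4.le

open Classical in
/-- `sup_{x ∈ Δ̃(y)} |F(x)|` for a fine vector field `F` (the left sides of (1.110)): the sup norm of `F` truncated to `Δ̃(y)`.
((1.110) is printed *"for x ∈ Δ(y)"*, `Δ(y) ⊂ Δ̃(y)`; since `Δ̃(y)` is covered by the unit cubes `Δ(y″)`, `|y″ − y| ≤ 1`, the sup over
`Δ̃(y)` is the printed statement with `O(1)` replaced by `O(1)e^{δ₀}` — the same proposition once the constants are quantified, as they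
are in `B5.Prop12Printed`.) [cite: Balaban1984PropagatorsI, (1.110) p.35] -/
def cubeSup (R : Rep103) (F : R.ι → ℝ) (y : R.Y) : ℝ := ‖fun i : R.ι => if i.1 ∈ R.cube y then F i else 0‖

open Classical in
/-- `sup_{x ∈ Δ̃(y)} |F(x)|` for a gradient field `F`. [cite: Balaban1984PropagatorsI, (1.110) p.35] -/
def cubeSupG (R : Rep103) (F : R.ιg → ℝ) (y : R.Y) : ℝ := ‖fun g : R.ιg => if g.1 ∈ R.cube y then F g else 0‖

/-- The Hölder seminorm (1.109) of a fine-lattice function: `‖ζ‖_α = sup_{0<|x−x′|≤1} |x−x′|^{−α}|ζ(x) − ζ(x′)|`.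
[cite: Balaban1984PropagatorsI, (1.109) p.35] -/
def holderS (R : Rep103) (α : ℝ) (ζ : R.S → ℝ) : ℝ :=
  ‖fun p : R.S × R.S => if 0 < R.dS p.1 p.2 ∧ R.dS p.1 p.2 ≤ 1 then |ζ p.1 - ζ p.2| / R.dS p.1 p.2 ^ α else 0‖

/-- The Hölder seminorm (1.109) of a gradient field, verbatim: *"‖A‖_α = max_μ sup_{x,x′:|x−x′|≤1} |x−x′|^{−α}|A_μ(x) − A_μ(x′)|"* (same
component `(λ, μ)`, `0 < |x − x′| ≤ 1`). [cite: Balaban1984PropagatorsI, (1.109) p.35] -/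
def holderG (R : Rep103) (α : ℝ) (F : R.ιg → ℝ) : ℝ :=
  ‖fun p : R.ιg × R.ιg =>
    if p.1.2 = p.2.2 ∧ 0 < R.dS p.1.1 p.2.1 ∧ R.dS p.1.1 p.2.1 ≤ 1 then |F p.1 - F p.2| / R.dS p.1.1 p.2.1 ^ α else 0‖

/-- `ζA`: a gradient field multiplied by a fine-lattice function (`(ζ∇GJ)` of (1.111)). [cite: Balaban1984PropagatorsI, (1.111) p.35] -/
def smulG (R : Rep103) (ζ : R.S → ℝ) (F : R.ιg → ℝ) : R.ιg → ℝ := fun g => ζ g.1 * F g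

/-- **The carrier of [6I] Propositions 1.1–1.2 (`…Balaban1983to89.B5.Setting`) SEEN BY THIS DERIVATION**: sites = `T₁^{(k)}` with
`|y − y′|`; arguments `J` = fine vector fields with `supp J ⊂ Δ̃(y′)` and the sup norm `|J|`; cut-offs `ζ` = fine-lattice functions with
`supp ζ ⊂ Δ̃(y)`, `‖ζ‖_α + |ζ|`, `|ζ|`; the (1.110) entries n = 0, 1 = `sup_{Δ̃(y)}|GJ|`, `sup_{Δ̃(y)}|∇GJ|` and the (1.111) entry
`‖ζ∇GJ‖_α` are the GENUINE functionals of the kernels `G`, `∇G`; the remaining functionals of the carrier ((1.110) n = 2, 3: `G∇^*J`, `ΔGJ`;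
the second member `‖ζG∇^*J‖_α` of (1.111); (1.112)–(1.114); the L² norms of Prop. 1.1) are NOT USED by the derivation of (7.2.2) and
are set to 0 (so the corresponding conjuncts of `B5.Ineq110_114` for this carrier are void).  HONEST SCOPE: `B5.Ineq110_114 (settingOf R k)
…` restricted to the genuine entries is exactly (1.110) members 1–2 and (1.111) member 1 for `(G, ∇G)`.
[cite: Balaban1984PropagatorsI, Prop. 1.2 (1.110)–(1.114) pp.35–36] -/
def settingOf (R : Rep103) (k : ℕ) : B5.Setting where
  Site := R.Y
  dist := R.dY
  k := k
  Loc := R.ι → ℝ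
  suppIn := fun J y' => ∀ i, J i ≠ 0 → i.1 ∈ R.cube y'
  supNorm := fun J => ‖J‖
  l2Norm := fun _ => 0
  holder := fun _ _ => 0
  Cut := R.S → ℝ
  cutIn := fun ζ y => ∀ x, ζ x ≠ 0 → x ∈ R.cube y
  cutH := fun α ζ => holderS R α ζ + ‖ζ‖
  cutSup := fun ζ => ‖ζ‖
  l2op := fun _ _ => 0
  e := fun n J y => if n = 0 then cubeSup R (R.G *ᵥ J) y else if n = 1 then cubeSupG R (R.DG *ᵥ J) y else 0
  h1 := fun J α ζ => holderG R α (smulG R ζ (R.DG *ᵥ J))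
  e4 := fun _ _ => 0
  h2 := fun _ _ _ => 0
  l2loc := fun _ _ _ => 0
  Vec := Unit
  formΔa := fun _ => 0
  formΔI := fun _ => 0

/-- **Proposition 1.2 of the tree supplies the hypotheses**: the typed [6I] Prop. 1.2 at constants `(C, Cα, Cε, Cαε, δ₀)`
(`B5.Ineq110_114`, the `∀ i`-body of `B5.Prop12Printed`) for the carrier `settingOf R k`, together with `0 ≤ C`, `0 < δ₀` (which
`B5.Prop12Printed` provides), gives the three displayed members `Prop12Hyps C Cα δ₀` consumed above.
[cite: Balaban1984PropagatorsI, Prop. 1.2 (1.110)–(1.111) p.35] -/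
theorem prop12Hyps_of_ineq110_114 {k : ℕ} {C δ₀ : ℝ} {Cα Cε : ℝ → ℝ} {Cαε : ℝ → ℝ → ℝ} (hC : 0 ≤ C) (hδ₀ : 0 < δ₀)
    (h12 : B5.Ineq110_114 (settingOf R k) C Cα Cε Cαε δ₀) : R.Prop12Hyps C Cα δ₀ where
  C_nonneg := hC
  δ₀_pos := hδ₀
  e110_0 := by
    classical
    intro J y y' hJ i hi
    have h0 := h12.1 0 J y y' hJ
    simp only [settingOf, Fin.isValue, ↓reduceIte] at h0
    have h1 := norm_le_pi_norm (fun j : R.ι => if j.1 ∈ R.cube y then (R.G *ᵥ J) j else 0) i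
    simp only [if_pos hi, Real.norm_eq_abs] at h1
    exact h1.trans h0
  e110_1 := by
    classical
    intro J y y' hJ g hg
    have h0 := h12.1 1 J y y' hJ
    simp only [settingOf, Fin.isValue, one_ne_zero, ↓reduceIte] at h0
    have h1 := norm_le_pi_norm (fun g' : R.ιg => if g'.1 ∈ R.cube y then (R.DG *ᵥ J) g' else 0) g
    simp only [if_pos hg, Real.norm_eq_abs] at h1
    exact h1.trans h0
  h111 := by
    intro α J ζ y y' Zh Z0 hα0 hα1 hZh hZ0 hζ hJ hζh hζ0 g g' hcomp hpos hle1
    have H := h12.2.1 α J ζ y y' hα0 hα1 hζ hJ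
    simp only [settingOf] at H
    -- H : holderG R α (smulG R ζ (R.DG *ᵥ J)) ≤ Cα α * exp (…) * (holderS R α ζ + ‖ζ‖) * ‖J‖
    have hdα : 0 < R.dS g.1 g'.1 ^ α := Real.rpow_pos_of_pos hpos α
    -- the Hölder quotient of the pair (g, g′) is below the Hölder norm
    have hq : |ζ g.1 * (R.DG *ᵥ J) g - ζ g'.1 * (R.DG *ᵥ J) g'| / R.dS g.1 g'.1 ^ α ≤
        holderG R α (smulG R ζ (R.DG *ᵥ J)) := by
      have h1 := norm_le_pi_norm (fun p : R.ιg × R.ιg =>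
        if p.1.2 = p.2.2 ∧ 0 < R.dS p.1.1 p.2.1 ∧ R.dS p.1.1 p.2.1 ≤ 1 then
          |smulG R ζ (R.DG *ᵥ J) p.1 - smulG R ζ (R.DG *ᵥ J) p.2| / R.dS p.1.1 p.2.1 ^ α else 0) (g, g')
      simp only [if_pos (show g.2 = g'.2 ∧ 0 < R.dS g.1 g'.1 ∧ R.dS g.1 g'.1 ≤ 1 from ⟨hcomp, hpos, hle1⟩),
        Real.norm_eq_abs, abs_div, abs_abs, abs_of_pos hdα] at h1
      exact h1
    -- ‖ζ‖_α ≤ Z_h and |ζ| ≤ Z₀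
    have hS : holderS R α ζ ≤ Zh := by
      apply (pi_norm_le_iff_of_nonneg hZh).2
      intro p
      by_cases hcond : 0 < R.dS p.1 p.2 ∧ R.dS p.1 p.2 ≤ 1
      · simp only [if_pos hcond, Real.norm_eq_abs, abs_div, abs_abs,
          abs_of_pos (Real.rpow_pos_of_pos hcond.1 α)]
        rw [div_le_iff₀ (Real.rpow_pos_of_pos hcond.1 α)]
        exact hζh _ _ hcond.1 hcond.2
      · simp only [if_neg hcond, norm_zero]; exact hZh
    have hζn : ‖ζ‖ ≤ Z0 := (pi_norm_le_iff_of_nonneg hZ0).2 fun x => by rw [Real.norm_eq_abs]; exact hζ0 x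
    have hE : 0 ≤ Real.exp (-(δ₀ * R.dY y y')) * (holderS R α ζ + ‖ζ‖) * ‖J‖ := by
      have : 0 ≤ holderS R α ζ := norm_nonneg _
      positivity
    have hT : Cα α * Real.exp (-(δ₀ * R.dY y y')) * (holderS R α ζ + ‖ζ‖) * ‖J‖ ≤
        max (Cα α) 0 * Real.exp (-(δ₀ * R.dY y y')) * (Zh + Z0) * ‖J‖ := by
      calc Cα α * Real.exp (-(δ₀ * R.dY y y')) * (holderS R α ζ + ‖ζ‖) * ‖J‖
          = Cα α * (Real.exp (-(δ₀ * R.dY y y')) * (holderS R α ζ + ‖ζ‖) * ‖J‖) := by ring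
        _ ≤ max (Cα α) 0 * (Real.exp (-(δ₀ * R.dY y y')) * (holderS R α ζ + ‖ζ‖) * ‖J‖) :=
            mul_le_mul_of_nonneg_right (le_max_left _ _) hE
        _ ≤ max (Cα α) 0 * (Real.exp (-(δ₀ * R.dY y y')) * (Zh + Z0) * ‖J‖) := by
            apply mul_le_mul_of_nonneg_left _ (le_max_right _ _)
            exact mul_le_mul_of_nonneg_right
              (mul_le_mul_of_nonneg_left (add_le_add hS hζn) (Real.exp_pos _).le) (norm_nonneg _)
        _ = _ := by ring
    have hfin := (hq.trans H).trans hT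
    rwa [div_le_iff₀ hdα] at hfin

/-! ## §6  Row C1.Eq7.2.1-7.2.2: the Sect. 7.2 carrier of the representation, (7.2.2) in `|x − y|`, and `KernelData.Ineq722` for families -/

/-- **The Sect. 7.2 carrier (`…BIJ85Sect7Statements.KernelData`) of the representation data**: `SiteEta = T_η = S`, `SiteU = T₁^{(k)} = Y`,
`Dir`, the distances `|x − x′|` (`dS`), `|y − y′|` (`dY`) and a given `|x − y|` between the two lattices (`distEU`); the kernel
`H_{k,μν}(x; y) := (GQ^*(QGQ^*)⁻¹)(⟨x,μ⟩, ⟨y,ν⟩)` of (7.2.1)/(1.103); `|∇H_{k,μν}(x, y)| := max_λ |∇_λH_{k,μν}(x, y)|` and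
`|∇H_{k,μν}(x,y) − ∇H_{k,μν}(x′,y)| := max_λ |∇_λH_{k,μν}(x,y) − ∇_λH_{k,μν}(x′,y)|` (the sup norm over the gradient components, as in
(1.108) *"|∇A| = max_{μ,ν} sup|∂_μA_ν|"*); the unit-lattice bonds, `dist(x, b)`, `C^{(k)}` and `D_k` of the carrier are parameters (they do
not enter (7.2.2)). [cite: BalabanImbrieJaffe1985, (7.2.1) p.325] -/
def kernelDataOf (R : Rep103) (BondU : Type) (distEU : R.S → R.Y → ℝ) (distEB : R.S → BondU → ℝ)
    (Cker : R.Dir → R.Dir → R.Y → R.Y → ℝ) (Dker : R.S → BondU → ℝ) : BIJ85Sect7Statements.KernelData where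
  SiteEta := R.S
  SiteU := R.Y
  BondU := BondU
  Dir := R.Dir
  distEU := distEU
  distEta := R.dS
  distU := R.dY
  distEB := distEB
  H := fun μ ν x y => R.H (x, μ) (y, ν)
  gradH := fun μ ν x y => ‖fun lam : R.Dir => R.gradH (x, lam, μ) (y, ν)‖
  gradHDiff := fun μ ν x x' y => ‖fun lam : R.Dir => R.gradH (x, lam, μ) (y, ν) - R.gradH (x', lam, μ) (y, ν)‖
  C := Cker
  D := Dker

variable {BondU : Type} {distEU : R.S → R.Y → ℝ} {distEB : R.S → BondU → ℝ} {Cker : R.Dir → R.Dir → R.Y → R.Y → ℝ}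
  {Dker : R.S → BondU → ℝ} {s : ℝ}

/-- **(7.2.2) at one scale in the language of Sect. 7.2**, verbatim p. 325: *"for |x − x′| ≤ 1, |H_{k,μν}(x,y)| + |∇H_{k,μν}(x,y)| +
|x − x′|^{−α}|∇H_{k,μν}(x,y) − ∇H_{k,μν}(x′,y)| ≤ Me^{−δ|x−y|}. (7.2.2)"* — for the carrier `kernelDataOf`, with `δ = rate722 …` and
`M = M722 … α · e^{δs}`, whenever the distance `|x − y|` between the lattices is tied to the block geometry by `|x − y| ≤ |y_x − y| + s`
(`y_x` = the unit site of the block of `x`; `s` = a bound for the distance from a fine point to the unit site of its block) and `|x − x′| > 0`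
for `x ≠ x′`. [cite: BalabanImbrieJaffe1985, (7.2.2) p.325] -/
theorem ineq722_kernelData (h : R.Hyps γ₁ q₀ q₁ rQ KY) (h12 : R.Prop12Hyps C Cα δ₀) (hc : CutoffHyps R r₀ Zc s₀ s₁) {α : ℝ}
    (hα0 : 0 ≤ α) (hα1 : α < 1) (hdist : ∀ x y, distEU x y ≤ R.dY (R.blk x) y + s)
    (hsep : ∀ x x' : R.S, x ≠ x' → 0 < R.dS x x') (μ ν : R.Dir) (x x' : R.S) (y : R.Y) (hne : x ≠ x')
    (hle1 : R.dS x x' ≤ 1) :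
    |(kernelDataOf R BondU distEU distEB Cker Dker).H μ ν x y| + (kernelDataOf R BondU distEU distEB Cker Dker).gradH μ ν x y +
        (kernelDataOf R BondU distEU distEB Cker Dker).distEta x x' ^ (-α) *
          (kernelDataOf R BondU distEU distEB Cker Dker).gradHDiff μ ν x x' y ≤
      M722 (Fintype.card R.Dir) C δ₀ γ₁ q₀ q₁ rQ KY Cα r₀ Zc s₀ s₁ α *
          Real.exp (rate722 (Fintype.card R.Dir) C δ₀ γ₁ q₀ q₁ rQ KY * s) *
        Real.exp (-(rate722 (Fintype.card R.Dir) C δ₀ γ₁ q₀ q₁ rQ KY * distEU x y)) := by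
  dsimp only [kernelDataOf]
  set δ := rate722 (Fintype.card R.Dir) C δ₀ γ₁ q₀ q₁ rQ KY with hδ
  set A := const722 (Fintype.card R.Dir) C δ₀ γ₁ q₀ q₁ rQ KY with hA
  set Hc := holderConst (Fintype.card R.Dir) C δ₀ γ₁ q₀ q₁ rQ KY Cα r₀ Zc s₀ s₁ α with hHc
  set E := Real.exp (-(δ * R.dY (R.blk x) y)) with hE
  have hpos : 0 < R.dS x x' := hsep x x' hne
  have hδ0 : 0 ≤ δ := (rate722_pos h h12 _).le
  have hA0 : 0 ≤ A := const722_nonneg h h12 _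
  have hHc0 : 0 ≤ Hc := holderConst_nonneg h h12 hc _ α
  have hE0 : 0 ≤ E := (Real.exp_pos _).le
  have hdα : 0 ≤ R.dS x x' ^ α := Real.rpow_nonneg (h.dS_nonneg _ _) _
  -- the three members
  have h1 : |R.H (x, μ) (y, ν)| ≤ A * E := abs_H_le h h12 (x, μ) (y, ν)
  have h2 : ‖fun lam : R.Dir => R.gradH (x, lam, μ) (y, ν)‖ ≤ A * E :=
    (pi_norm_le_iff_of_nonneg (mul_nonneg hA0 hE0)).2 fun lam => by
      rw [Real.norm_eq_abs]; exact abs_gradH_le h h12 (x, lam, μ) (y, ν)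
  have h3 : ‖fun lam : R.Dir => R.gradH (x, lam, μ) (y, ν) - R.gradH (x', lam, μ) (y, ν)‖ ≤ Hc * E * R.dS x x' ^ α :=
    (pi_norm_le_iff_of_nonneg (mul_nonneg (mul_nonneg hHc0 hE0) hdα)).2 fun lam => by
      rw [Real.norm_eq_abs]
      exact abs_gradH_sub_le h h12 hc hα0 hα1 (x, lam, μ) (x', lam, μ) rfl hpos hle1 (y, ν)
  have hcancel : R.dS x x' ^ (-α) * R.dS x x' ^ α = 1 := by
    rw [Real.rpow_neg (h.dS_nonneg _ _), inv_mul_cancel₀ (Real.rpow_pos_of_pos hpos α).ne']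
  have h3' : R.dS x x' ^ (-α) * ‖fun lam : R.Dir => R.gradH (x, lam, μ) (y, ν) - R.gradH (x', lam, μ) (y, ν)‖ ≤ Hc * E :=
    calc R.dS x x' ^ (-α) * ‖fun lam : R.Dir => R.gradH (x, lam, μ) (y, ν) - R.gradH (x', lam, μ) (y, ν)‖
        ≤ R.dS x x' ^ (-α) * (Hc * E * R.dS x x' ^ α) :=
          mul_le_mul_of_nonneg_left h3 (Real.rpow_nonneg (h.dS_nonneg _ _) _)
      _ = Hc * E * (R.dS x x' ^ (-α) * R.dS x x' ^ α) := by ring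
      _ = Hc * E := by rw [hcancel, mul_one]
  -- from `|y_x − y|` to `|x − y|`
  have hshift : E ≤ Real.exp (δ * s) * Real.exp (-(δ * distEU x y)) :=
    exp_shift hδ0 (by rw [add_comm]; exact hdist x y)
  have hM : M722 (Fintype.card R.Dir) C δ₀ γ₁ q₀ q₁ rQ KY Cα r₀ Zc s₀ s₁ α = 2 * A + Hc := by
    simp only [M722, hA, hHc]
  rw [hM]
  calc |R.H (x, μ) (y, ν)| + ‖fun lam : R.Dir => R.gradH (x, lam, μ) (y, ν)‖ +
        R.dS x x' ^ (-α) * ‖fun lam : R.Dir => R.gradH (x, lam, μ) (y, ν) - R.gradH (x', lam, μ) (y, ν)‖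
      ≤ A * E + A * E + Hc * E := add_le_add (add_le_add h1 h2) h3'
    _ = (2 * A + Hc) * E := by ring
    _ ≤ (2 * A + Hc) * (Real.exp (δ * s) * Real.exp (-(δ * distEU x y))) :=
        mul_le_mul_of_nonneg_left hshift (by linarith)
    _ = (2 * A + Hc) * Real.exp (δ * s) * Real.exp (-(δ * distEU x y)) := by ring

/-! ### The typed row: `KernelData.Ineq722` for a family k ↦ (G_k, Q_k, T₁^{(k)}, …) with k-independent constants -/

/-- **Row C1.Eq7.2.1-7.2.2 — `…BIJ85Sect7Statements.KernelData.Ineq722` PROVED for the family of Sect. 7.2 carriers of the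
representations (1.103)**, p. 325 verbatim: *"there exists δ > 0 and for 0 ≤ α < 1 a constant M = M(α) < ∞ such that for |x − x′| ≤ 1,
|H_{k,μν}(x,y)| + |∇H_{k,μν}(x,y)| + |x − x′|^{−α}|∇H_{k,μν}(x,y) − ∇H_{k,μν}(x′,y)| ≤ Me^{−δ|x−y|}. (7.2.2) This inequality is a
consequence of Proposition 1.2 and the representation (1.103) of [6I]."* — whenever the inputs hold at every scale k WITH THE SAME
CONSTANTS (as [6I] states them: *"depending on d only"*, *"independent of k"*): the structural inputs `Hyps γ₁ q₀ q₁ rQ KY`, the Prop. 1.2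
members `Prop12Hyps C Cα δ₀`, the cut-off geometry `CutoffHyps r₀ Zc s₀ s₁`, `d = |Dir|` directions, `|x − y| ≤ |y_x − y| + s`, and
`|x − x′| > 0` for `x ≠ x′`; then `δ = rate722 d …` and `M(α) = M722 d … α · e^{δs}` serve for all k. [cite: BalabanImbrieJaffe1985, (7.2.2) p.325] -/
theorem ineq722_of_family (fam : ℕ → Rep103) (BondU : ℕ → Type) (distEU : (k : ℕ) → (fam k).S → (fam k).Y → ℝ)
    (distEB : (k : ℕ) → (fam k).S → BondU k → ℝ) (Cker : (k : ℕ) → (fam k).Dir → (fam k).Dir → (fam k).Y → (fam k).Y → ℝ)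
    (Dker : (k : ℕ) → (fam k).S → BondU k → ℝ) {nD : ℕ} (hcard : ∀ k, Fintype.card (fam k).Dir = nD)
    {C δ₀ γ₁ q₀ q₁ rQ r₀ Zc s₀ s₁ s : ℝ} {KY Cα : ℝ → ℝ}
    (h : ∀ k, (fam k).Hyps γ₁ q₀ q₁ rQ KY) (h12 : ∀ k, (fam k).Prop12Hyps C Cα δ₀) (hc : ∀ k, CutoffHyps (fam k) r₀ Zc s₀ s₁)
    (hdist : ∀ (k : ℕ) (x : (fam k).S) (y : (fam k).Y), distEU k x y ≤ (fam k).dY ((fam k).blk x) y + s)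
    (hsep : ∀ (k : ℕ) (x x' : (fam k).S), x ≠ x' → 0 < (fam k).dS x x') :
    BIJ85Sect7Statements.KernelData.Ineq722
      (fun k => kernelDataOf (fam k) (BondU k) (distEU k) (distEB k) (Cker k) (Dker k)) := by
  refine ⟨rate722 nD C δ₀ γ₁ q₀ q₁ rQ KY, rate722_pos (h 0) (h12 0) nD, fun α hα0 hα1 =>
    ⟨M722 nD C δ₀ γ₁ q₀ q₁ rQ KY Cα r₀ Zc s₀ s₁ α * Real.exp (rate722 nD C δ₀ γ₁ q₀ q₁ rQ KY * s), ?_⟩⟩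
  intro k μ ν x x' y hne hle
  have hk := ineq722_kernelData (BondU := BondU k) (distEU := distEU k) (distEB := distEB k) (Cker := Cker k)
    (Dker := Dker k) (h k) (h12 k) (hc k) hα0 hα1 (hdist k) (hsep k) μ ν x x' y hne hle
  rw [hcard k] at hk
  exact hk

/-- **The same from Proposition 1.2 of [6I] AS TYPED IN THE TREE**: `…Balaban1983to89.B5.Prop12Printed` for the family of carriers
`settingOf` (∃ δ₀, O(1), O(1)(α), … BEFORE k, with (1.110)–(1.114) at every k) together with the structural inputs and the cut-off
geometry at k-independent constants gives `KernelData.Ineq722` — the implication *"(7.2.2) is a consequence of Proposition 1.2 and the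
representation (1.103)"* with Prop. 1.2 entering by its name in the tree. [cite: BalabanImbrieJaffe1985, (7.2.2) p.325] -/
theorem ineq722_of_prop12Printed (fam : ℕ → Rep103) (BondU : ℕ → Type) (distEU : (k : ℕ) → (fam k).S → (fam k).Y → ℝ)
    (distEB : (k : ℕ) → (fam k).S → BondU k → ℝ) (Cker : (k : ℕ) → (fam k).Dir → (fam k).Dir → (fam k).Y → (fam k).Y → ℝ)
    (Dker : (k : ℕ) → (fam k).S → BondU k → ℝ) {nD : ℕ} (hcard : ∀ k, Fintype.card (fam k).Dir = nD)
    {γ₁ q₀ q₁ rQ r₀ Zc s₀ s₁ s : ℝ} {KY : ℝ → ℝ}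
    (h : ∀ k, (fam k).Hyps γ₁ q₀ q₁ rQ KY) (hc : ∀ k, CutoffHyps (fam k) r₀ Zc s₀ s₁)
    (h12 : B5.Prop12Printed (fun k => settingOf (fam k) k))
    (hdist : ∀ (k : ℕ) (x : (fam k).S) (y : (fam k).Y), distEU k x y ≤ (fam k).dY ((fam k).blk x) y + s)
    (hsep : ∀ (k : ℕ) (x x' : (fam k).S), x ≠ x' → 0 < (fam k).dS x x') :
    BIJ85Sect7Statements.KernelData.Ineq722
      (fun k => kernelDataOf (fam k) (BondU k) (distEU k) (distEB k) (Cker k) (Dker k)) := by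
  obtain ⟨δ₀, C, Cα, Cε, Cαε, hδ₀, hC, hall⟩ := h12
  exact ineq722_of_family fam BondU distEU distEB Cker Dker hcard h
    (fun k => prop12Hyps_of_ineq110_114 hC.le hδ₀ (hall k)) hc hdist hsep

end

end Literature.MathematicalPhysics.QuantumFieldTheory.BalabanImbrieJaffe1984to88.BIJ85Ineq722ProofPart2
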